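import Summits.QuantumFields.BalabanUV.T4Continuum.Spine.NE1p.DressedSmallFieldMixedDerivativeLetter

/-!
# T⁴ programme, spine estimate NE1′ (node O3b/H2) — THE `t_□`-CONTOUR OF (1.23): the substrate's one-variable Cauchy weight AT `t = 0` on a
# circle of ANY radius `ρ > 0` (print's (1.22) circle is SMALL, `|t_□| ≪ 1`) reproduces `∂∕∂t_□|_{t_□=0}`, costs exactly `ρ⁻¹ = |t_□|⁻¹`
# (the first factor of (1.24)), and — wrapped around W55's cube contours — gives (1.23)'s FULL inner object `∂∕∂t_□|₀ ∂^S E` for a jointly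
# analytic `E`

Cell `pub-balaban`, sub-cell `t4`, row NE1′ formalisation crew (`t4/formal/NE1p/LEAVES.md` row W⟨next⟩ — own-initiative follower of the unit's
W55∕W57∕W60 under typer R-T61 (ii)), unit `b2b-balaban-t4-ne1p-formalise-leaf-08` (gen 11).  ADDITIVE — imports W55 PART 2
`Spine/NE1p/DressedSmallFieldMixedDerivativeLetter` ONLY (→ PART 1, W39.1, the NE5 substrate `Support/B13TermContours`: `w₁`, `circ`, `interp_eq_self`,
`norm_circ`, `circ_eq_circleMap`, `measurable_w₁` BY NAME; Dimock `mixedDeriv` BY NAME; W55: `mixedDerivLetter_rep`, `differentiable_mixedDeriv_cons`,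
`analyticOnNhd_cons_section`, `analyticOnNhd_apply`, `mixedDeriv_enumS_const_mul`, `mixedDeriv_enumS_prod` BY NAME); THEOREMS ONLY (0 def, 0
`def … : Prop`, 0 cite, 0 sorry, 0 `attribute`) + 2 decided `example`s; nothing of the substrate ∕ W55 ∕ the Literature module restated — the
substrate's `setIntegral_w₁_mul_eq_deriv` (hypothesis `1 < r`, point `t ∈ [0,1]`) is NOT re-proved: §1 is its `t = 0` companion for radii
`0 < ρ ≤ 1`, which the substrate's hypothesis excludes and print's (1.22) requires.

WHY THIS FILE.  [Balaban1988RGII] p. 7: «We differentiate it with respect to t_□, at t_□ = 0, and we represent all derivatives by the Cauchy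
formula», (1.22) «1∕|t_□| = 8B₀C₁e^{16κ₁}α₂⁻¹g_k|B| < 8B₀C₁e^{16κ₁}α₂⁻¹ε₁», (1.23) «(1∕2πi)∮ dt_□∕t_□² Π_{Δ⊂Y₀∖□̃⁴} ∫ ds(Δ) (1∕2πi)∫
dσ(Δ)∕(σ(Δ) − s(Δ))² · E(□₀, (tζ̃_□ + t_□ζ_□)H_k(σ(Y₀), B′))» «where the t_□-integration is over the circle (1.22), and the σ(Δ)-integrations
are over the circles |σ(Δ)| = e^{κ₁}», (1.24) «|(1.23)| ≤ 8B₀C₁e^{16κ₁}α₂⁻¹g_k|B| E₀(…)⁵(L^jη)⁵ · exp(−(κ₁ − 1)M⁻⁴|Y₀∖□̃⁴|) exp(−κd_j(X))»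
— LOCI of the audited manuscript (render p. 7 read as an image), TYPE∕CONTEXT only.  W39.1∕W55∕W57∕W60 handle the `σ(Δ)`-contours (radii
`> 1`, interpolation points `s ∈ [0,1]^S`).  The `t_□`-contour is different in kind: NO interpolation (a derivative AT `t_□ = 0`) and a SMALL
circle (radius `|t_□| < 1` by (1.22)), outside the substrate lemma's hypothesis `1 < r`.  Here:
* §1 **`tBoxLetter_rep`** (`∫_{[0,2π]} w₁ ρ (0,θ)·f(circ ρ θ) dθ = f′(0)` for `f` holomorphic near the closed disc of ANY radius `ρ > 0` —
  Mathlib `two_pi_I_inv_smul_circleIntegral_sub_sq_inv_smul_of_differentiable`), **`norm_w₁_zero`** (`‖w₁ ρ (0,θ)‖ = (2πρ)⁻¹` EXACTLY),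
  **`integral_norm_w₁_zero`** (the letter's mass is EXACTLY `ρ⁻¹ = |t_□|⁻¹` — (1.22)'s quantity, (1.24)'s first factor, TYPE),
  `norm_deriv_zero_le_tBoxLetter` (`‖f′(0)‖ ≤ ρ⁻¹·B` through the letter — the same number as Mathlib's Cauchy estimate
  `Complex.norm_deriv_le_of_forall_mem_sphere_norm_le`, recorded as the letter's cost);
* §2 `differentiable_tSection` (W55 BY NAME) and **`tBoxCubeLetter_rep`**: for `E : ℂⁿ⁺¹ → ℂ` JOINTLY ENTIRE (`t_□` as coordinate `0`), cube radii
  `> 1`, ANY `ρ > 0`, `s_j ∈ [0,1]` on `S`: `∫_{θ_□} w₁ ρ (0,θ_□)·(∫ wS r S (s,θ)·E(circ ρ θ_□ ∷ σ_S(s,θ)) Π dθ) dθ_□ =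
  deriv (t ↦ ∂_{enumS S}(E(t ∷ ·))(basePt S s)) 0` — W55 P2's `mixedDerivLetter_rep` on every section, then §1 on W55's ENTIRE `t`-section:
  (1.23)'s displayed operator read at fixed `s`;
* §3 two DECIDED checks (`f(t) = t(1+t)`, `ρ = 1∕4 < 1`, letter `= 1`; `E(t,z₀) = t z₀` on one cube, combined letter `= 1`).

HONEST FRAMING.  [folklore] one-variable Cauchy formula for a first derivative (Mathlib) in the substrate's weight normalisation + by-name
composition with W55; a DICTIONARY for (1.23)'s `t_□`-contour, not an estimate of print: `ρ` is symbolic (print's `|t_□|` of (1.22) is a TYPE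
READING with symbolic letters `B₀, C₁, κ₁, α₂, g_k, |B|` — NONE of them is instantiated, no numeral of [Balaban1988RGII] asserted (k2)); `f`∕`E` ↔
print's `E(□₀, (tζ̃_□ + t_□ζ_□)H_k(σ(Y₀),B′))` and the cube radii ↔ (1.23)'s σ(Δ)-circles `|σ(Δ)| = e^{κ₁}` are TYPE READINGS; `‖f‖ ≤ B` on the
circle is a HYPOTHESIS ((1.21) TYPE); the hypothesis JOINTLY ENTIRE for §2 (local versions follow W57's pattern, NOT claimed); (B1) for Bałaban's
(2.14) NOT discharged; (B3) = GAPS G-ne9p2-5 UNPRINTED — NOT discharged, untouched; (B5) untouched; 0 binders instantiated on Bałaban's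
densities ∕ operators ∕ (2.14) data ∕ `d_k` ∕ minimisers ∕ backgrounds; discharges no wall item; wall v1.8 (T4-DAG v48) does NOT move; R-t4r2-Q2
NOT met thereby; NE1′ ⇐ the named binders — NOT proved, NOT printed; spine PROVED 0∕9; count 9 unchanged.  Rung (B)+1 on ONE finite
four-torus — NOT infinite volume, NOT a mass gap, NOT OS on ℝ⁴, NOT Clay.  ABSOLUTE RULE honoured: the quotations are LOCI of the audited
manuscript [Balaban1988RGII] (CMP 116 (1988) 1–22, p. 7), TYPE∕CONTEXT only, never hypothesis-free facts; nothing internally minted is cited;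
[folklore]∕[arith] tags on kernel lemmas only.  HONEST DEPENDENCY: continuum YM on T⁴ ⇐ BetaPertH ∧ nine spine estimates (0/9 proved); BetaPertH ⇐ (D1) ∧ (D4) ∧
CAP+tail; G-an2-4 gates asym, D1 and NE2/3/4.
-/

noncomputable section

namespace Summit.QuantumFields.BalabanUV.T4Continuum.NE1p.DressedSmallFieldTBoxLetter

open MeasureTheory Metric Set Complex Finset Function
open scoped BigOperators
open Summit.QuantumFields.BalabanUV.T4Continuum.B13TermContours
open Summit.QuantumFields.BalabanUV.T4Continuum.NE1p.DressedSmallFieldMixedLetter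
open Summit.QuantumFields.BalabanUV.T4Continuum.NE1p.DressedSmallFieldMixedDerivativeBridge
open Summit.QuantumFields.BalabanUV.T4Continuum.NE1p.DressedSmallFieldMixedDerivativeLetter
open Literature.MathematicalPhysics.QuantumFieldTheory.Dimock2011to13.PolydiscCauchyBounds (mixedDeriv analyticOnNhd_mixedDeriv)

variable {n : ℕ}

/-! ## §1 THE `t_□`-LETTER: the substrate's ONE-variable weight AT `t = 0` on a circle of ANY radius `ρ > 0` -/

/-- **THE SUBSTRATE's ONE-VARIABLE LETTER AT `t = 0` FOR EVERY RADIUS `ρ > 0`** ([Balaban1988RGII] p. 7: «We differentiate it with respect to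
`t_□`, at `t_□ = 0`, and we represent all derivatives by the Cauchy formula», the `t_□`-integration running «over the circle (1.22)» — whose
radius `|t_□| = (8B₀C₁e^{16κ₁}α₂⁻¹g_k|B|)⁻¹` is SMALL; TYPE∕CONTEXT only): for `f` holomorphic on an open `U ⊇ closedBall 0 ρ`,
`∫_{θ∈[0,2π]} w₁ ρ (0, θ)·f(circ ρ θ) dθ = f′(0)`.  The substrate's `setIntegral_w₁_mul_eq_deriv` needs `1 < r` only to place the
interpolated point `t ∈ [0,1]` inside the circle; at `t = 0` any `ρ > 0` does (same Mathlib Cauchy formula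
`two_pi_I_inv_smul_circleIntegral_sub_sq_inv_smul_of_differentiable`). [folklore] -/
theorem tBoxLetter_rep {ρ : ℝ} (hρ : 0 < ρ) {U : Set ℂ} (hU : IsOpen U) (hsub : closedBall (0 : ℂ) ρ ⊆ U) {f : ℂ → ℂ}
    (hf : DifferentiableOn ℂ f U) : ∫ θ in Icc 0 (2 * Real.pi), w₁ ρ (0, θ) * f (circ ρ θ) = deriv f 0 := by
  have h0 : ((0 : ℝ) : ℂ) ∈ ball (0 : ℂ) ρ := by simpa using hρ
  have key := Complex.two_pi_I_inv_smul_circleIntegral_sub_sq_inv_smul_of_differentiable hU hsub hf h0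
  rw [Complex.ofReal_zero] at key
  rw [← key, circleIntegral_def_Icc, smul_eq_mul, ← integral_const_mul]
  refine setIntegral_congr_fun measurableSet_Icc fun θ _ => ?_
  simp only [w₁, interp_eq_self le_rfl zero_le_one, deriv_circleMap, smul_eq_mul, circ_eq_circleMap, Complex.ofReal_zero]
  ring

/-- [arith] **THE WEIGHT AT `t = 0` HAS MODULUS `(2πρ)⁻¹`** on the circle of radius `ρ > 0` (exactly; no `r > 1` needed). -/
theorem norm_w₁_zero {ρ : ℝ} (hρ : 0 < ρ) (θ : ℝ) : ‖w₁ ρ (0, θ)‖ = (2 * Real.pi * ρ)⁻¹ := by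
  have hc : ‖circ ρ θ‖ = ρ := norm_circ hρ.le θ
  have hπ : 0 < 2 * Real.pi := by positivity
  unfold w₁
  simp only [interp_eq_self le_rfl zero_le_one, Complex.ofReal_zero, sub_zero, norm_mul, norm_inv, norm_pow, Complex.norm_I, one_mul,
    hc, Complex.norm_real, Complex.norm_ofNat, Real.norm_of_nonneg Real.pi_pos.le]
  field_simp

/-- [arith] **THE `t_□`-LETTER COSTS EXACTLY `ρ⁻¹ = |t_□|⁻¹`** — print's (1.22) quantity «1∕|t_□| = 8B₀C₁e^{16κ₁}α₂⁻¹g_k|B|», the first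
factor of (1.24) (TYPE): `∫_{θ∈[0,2π]} ‖w₁ ρ (0,θ)‖ dθ = ρ⁻¹`. -/
theorem integral_norm_w₁_zero {ρ : ℝ} (hρ : 0 < ρ) : ∫ θ in Icc 0 (2 * Real.pi), ‖w₁ ρ (0, θ)‖ = ρ⁻¹ := by
  simp_rw [norm_w₁_zero hρ]
  rw [setIntegral_const, Real.volume_real_Icc_of_le (by positivity), sub_zero, smul_eq_mul]
  have hπ : Real.pi ≠ 0 := Real.pi_pos.ne'
  field_simp

/-- **THE `t_□`-LETTER's BOUND** (kernel, through the letter: `‖∫ w·f‖ ≤ ∫‖w‖·B`): `‖f′(0)‖ ≤ ρ⁻¹·B` for `‖f‖ ≤ B` on the circle — the SAME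
number Mathlib's Cauchy estimate `Complex.norm_deriv_le_of_forall_mem_sphere_norm_le` gives; recorded as the letter's cost `|t_□|⁻¹·B`,
(1.24)'s first factor times the sup. [folklore] -/
theorem norm_deriv_zero_le_tBoxLetter {ρ : ℝ} (hρ : 0 < ρ) {U : Set ℂ} (hU : IsOpen U) (hsub : closedBall (0 : ℂ) ρ ⊆ U) {f : ℂ → ℂ}
    (hf : DifferentiableOn ℂ f U) {B : ℝ} (hB : ∀ θ, ‖f (circ ρ θ)‖ ≤ B) : ‖deriv f 0‖ ≤ ρ⁻¹ * B := by
  rw [← tBoxLetter_rep hρ hU hsub hf]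
  have hπ : Real.pi ≠ 0 := Real.pi_pos.ne'
  calc ‖∫ θ in Icc 0 (2 * Real.pi), w₁ ρ (0, θ) * f (circ ρ θ)‖
      ≤ ∫ θ in Icc 0 (2 * Real.pi), ‖w₁ ρ (0, θ) * f (circ ρ θ)‖ := norm_integral_le_integral_norm _
    _ ≤ ∫ _ in Icc 0 (2 * Real.pi), (2 * Real.pi * ρ)⁻¹ * B :=
        integral_mono_of_nonneg (Filter.Eventually.of_forall fun _ => norm_nonneg _) (integrable_const _)
          (Filter.Eventually.of_forall fun θ => by
            dsimp only
            rw [norm_mul, norm_w₁_zero hρ]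
            exact mul_le_mul_of_nonneg_left (hB θ) (by positivity))
    _ = ρ⁻¹ * B := by
        rw [setIntegral_const, Real.volume_real_Icc_of_le (by positivity), sub_zero, smul_eq_mul]
        field_simp

/-! ## §2 (1.23)'s FULL INNER OBJECT: the `t_□`-contour AROUND the `σ(Δ)`-contours is `∂∕∂t_□|_{t_□=0} ∂^S E` -/

/-- [folklore] For `E : ℂⁿ⁺¹ → ℂ` jointly entire (the `t_□`-variable as coordinate `0`), the function
`t ↦ ∂_{enumS S}(E(t ∷ ·))(basePt S s)` is entire — W55's bridge `differentiable_mixedDeriv_cons` (Dimock's analyticity BY NAME). -/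
theorem differentiable_tSection {E : (Fin (n + 1) → ℂ) → ℂ} (hE : AnalyticOnNhd ℂ E univ) (S : Finset (Fin n)) (s : Fin n → ℝ) :
    Differentiable ℂ fun t : ℂ => mixedDeriv (enumS n S) (fun w => E (Fin.cons t w)) (basePt S s) :=
  differentiable_mixedDeriv_cons hE _ _

/-- **THE `t_□`-CONTOUR AROUND THE CUBE CONTOURS IS `∂∕∂t_□|₀ ∂^S E`** (kernel; W55 PART 2's `mixedDerivLetter_rep` on every section
`σ ↦ E(τ ∷ σ)` — `τ = circ ρ θ_□` on the `t_□`-circle — then §1's `tBoxLetter_rep` on the ENTIRE `t ↦ ∂_{enumS S}(E(t ∷ ·))(basePt S s)`):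
for radii `r j > 1` on the cubes, ANY `ρ > 0` on the `t_□`-circle, `E` JOINTLY entire and `s_j ∈ [0,1]` on the active cubes,
`∫_{θ_□} w₁ ρ (0,θ_□) · (∫ wS r S (s,θ)·E(circ ρ θ_□ ∷ σ_S(s,θ)) Π dθ) dθ_□ = deriv (t ↦ ∂_{enumS S}(E(t ∷ ·))(basePt S s)) 0` — (1.23)'s
displayed operator «(1∕2πi)∮ dt_□∕t_□² Π_Δ ∫ ds(Δ) (1∕2πi)∮ dσ(Δ)∕(σ(Δ)−s(Δ))² · E» read at fixed `s` (the `∫ ds(Δ)` being W39.1's∕the FTC row's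
business). [folklore] -/
theorem tBoxCubeLetter_rep {ρ : ℝ} (hρ : 0 < ρ) (r : Fin n → ℝ) (hr : ∀ j, 1 < r j) (S : Finset (Fin n))
    {E : (Fin (n + 1) → ℂ) → ℂ} (hE : AnalyticOnNhd ℂ E univ) (s : Fin n → ℝ) (hs : ∀ j ∈ S, s j ∈ Icc (0 : ℝ) 1) :
    ∫ θ₀ in Icc 0 (2 * Real.pi), w₁ ρ (0, θ₀) *
        ∫ θ, wS r S (pairθ s θ) * E (Fin.cons (circ ρ θ₀) (σS r S (pairθ s θ))) ∂(Measure.pi (θS S)) =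
      deriv (fun t : ℂ => mixedDeriv (enumS n S) (fun w => E (Fin.cons t w)) (basePt S s)) 0 := by
  have hinner : ∀ θ₀ : ℝ, ∫ θ, wS r S (pairθ s θ) * E (Fin.cons (circ ρ θ₀) (σS r S (pairθ s θ))) ∂(Measure.pi (θS S)) =
      mixedDeriv (enumS n S) (fun w => E (Fin.cons (circ ρ θ₀) w)) (basePt S s) := fun θ₀ =>
    mixedDerivLetter_rep n r S (fun w => E (Fin.cons (circ ρ θ₀) w)) s hr (analyticOnNhd_cons_section hE _) hs
  simp_rw [hinner]
  exact tBoxLetter_rep hρ isOpen_univ (subset_univ _) (differentiable_tSection hE S s).differentiableOn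

/-! ## §3 Decided checks -/

/-- DECIDED CHECK (the `t_□`-letter alone, radius BELOW one): for `f(t) = t·(1 + t)` and `ρ = 1∕4`, the letter returns `f′(0) = 1`. -/
example : ∫ θ in Icc 0 (2 * Real.pi), w₁ (1 / 4) (0, θ) * (circ (1 / 4) θ * (1 + circ (1 / 4) θ)) = 1 := by
  have h := tBoxLetter_rep (ρ := 1 / 4) (by norm_num) isOpen_univ (subset_univ _) (f := fun t => t * (1 + t))
    ((differentiable_id.mul (differentiable_const _ |>.add differentiable_id)).differentiableOn)
  rw [h]
  have hd : HasDerivAt (fun t : ℂ => t * (1 + t)) (1 * (1 + 0) + 0 * (0 + 1)) 0 :=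
    (hasDerivAt_id 0).mul ((hasDerivAt_const 0 (1 : ℂ)).add (hasDerivAt_id 0))
  rw [hd.deriv]; norm_num

/-- DECIDED CHECK (the combined letter): for `E(t, z₀) = t·z₀` on ONE cube (`S = univ` of `Fin 1`), any cube radius `> 1` and the
`t_□`-radius `1∕4 < 1`: the `t_□`-contour around the cube contour at `s₀ ∈ [0,1]` returns `∂_t|₀ ∂₀ (t z₀) = 1`. -/
example (r : Fin 1 → ℝ) (hr : ∀ j, 1 < r j) (s : Fin 1 → ℝ) (hs : ∀ j, s j ∈ Icc (0 : ℝ) 1) :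
    ∫ θ₀ in Icc 0 (2 * Real.pi), w₁ (1 / 4) (0, θ₀) *
        ∫ θ, wS r Finset.univ (pairθ s θ) * (circ (1 / 4) θ₀ * σS r Finset.univ (pairθ s θ) 0) ∂(Measure.pi (θS Finset.univ)) = 1 := by
  have hE : AnalyticOnNhd ℂ (fun z : Fin 2 → ℂ => z 0 * z 1) univ := (analyticOnNhd_apply 0).mul (analyticOnNhd_apply 1)
  have h := tBoxCubeLetter_rep (ρ := 1 / 4) (by norm_num) r hr Finset.univ hE s (fun j _ => hs j)
  simp only [Fin.cons_zero, Fin.cons_one] at h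
  -- the inner mixed derivative: `∂₀ (t · w 0)` at the base point is `t` (W55's product face), then `d∕dt (t) = 1`
  have hp : ∀ t : ℂ, mixedDeriv (enumS 1 Finset.univ) (fun w : Fin 1 → ℂ => t * w 0) (basePt Finset.univ s) = t := by
    intro t
    have h2 : (fun w : Fin 1 → ℂ => t * w 0) = fun w => t * ∏ j ∈ (Finset.univ : Finset (Fin 1)), (fun _ : Fin 1 => (id : ℂ → ℂ)) j (w j) := by
      funext w; simp
    rw [h2, mixedDeriv_enumS_const_mul, mixedDeriv_enumS_prod]; simp
  rw [h]
  simp_rw [hp]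
  exact (hasDerivAt_id (0 : ℂ)).deriv

end Summit.QuantumFields.BalabanUV.T4Continuum.NE1p.DressedSmallFieldTBoxLetter

end
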